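import Literature.NumberTheory.Automorphic.UnitaryGroupBorelPair        -- ★ `unitaryGroupOfForm`, ★ `glDiagonal`
import Literature.NumberTheory.Automorphic.GLnCongruenceSubgroups       -- ★ `congruenceGL` (`GL_N(𝒪)` = level `1`, principal congruence subgroups)
import Mathlib.Data.Matrix.ColumnRowPartitioned
import HarnessLib

/-!
# K2 ∕ E3 «EllipticInputs», 13a road A — DEFS LEAF D₁ (part 1∕2) `K2E3LocalUnitaryWittDefs`: the Witt frame of a unitary group —
# Witt normal form `wittForm ∕ wittFormOn`, Witt cocharacters, integral levels `K₀ = U ∩ GL_N(𝒪)` (part 2∕2 = ★ `K2E3LocalUnitaryWittParabolicDefs`: `P_S, M_S, N_S, N_S⁻`)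

Cell `hodgecm-mathlib` (Track B «K2-LIT»), item h413 = `stmt-HodgeConjecture-24833`, line `K2_E3_EllipticInputs`, socket U12-g ∕ 13a (`sig_K2E3LocalIrrepAdmissible`,
road A = Jacquet's admissibility theorem for `U_N(H)(L⁺_v)`).  Author K2-defs1 (g2) (Track B defs pen) on the DOCKING SPEC of K2E3-p13 (g0)
`MEMO-13a-admissibility-generalN` §5 «D» and the CONVENTION fixed by K2E3-p10 (g2) (K2/STATUS 2026-09-03T23:15:49Z); count-neutral; `--supports … --as helper`.
DEFINITIONS WITH BODIES + `rfl`∕entry lemmas + ONE small membership theorem (the Witt cocharacter is unitary); no `sorry`, no named fact, no `instance`, no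
`notation`.  The THEOREM half D₂ (`standardParabolicTriple σ J S : ParabolicTriple ↥U` = the Levi decomposition `P_S ∩ U = (M_S ∩ U) ⋉ (N_S ∩ U)` INSIDE `U`,
and `leviTriple`) is deliberately NOT here: ★ `ParabolicTriple` carries the proof fields `le_normalizer` ∕ `isComplement'` (theorem content, the block version of
★ `UnitaryGroup.isComplement'_torusU_unipotentU`); D₂ is a prover file over the subgroups defined below.

CONVENTION (K2E3-p10).  Witt index `r`, anisotropic kernel of size `m`, `N = 2r + m`; `WittIndex r m := Fin r ⊕ (Fin m ⊕ Fin r)` read as the ordered basis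
`(e₁, …, e_r ∣ u₁, …, u_m ∣ f_r, …, f₁)` — the `f`-slots REVERSED (slot `j` holds `f_{rev j}`), so `e_i` pairs with the slot `rev i`.  Pairing block `wittPairing R r =
(δ_{i, rev j})`; **Witt normal form** `wittForm r Han = fromBlocks 0 (fromCols 0 (wittPairing R r)) (fromRows 0 (wittPairing R r)) (fromBlocks Han 0 0 0)`
(`h(e_i, f_i) = 1`, `Han` on the `u`-block, `0` elsewhere); on a carrier `n` along `e : WittIndex r m ≃ n`: `wittFormOn e Han := reindex e e (wittForm r Han)`.  In
this order every standard parabolic is BLOCK-UPPER-TRIANGULAR (a pull-back of ★ `standardParabolicGL`), and `r = ⌊N∕2⌋`, `Han = (1)` reproduces Mok's `Φ_N`.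
★ `K2E3HermitianWittBasis.exists_GL_formCongr_eq_wittMatrix_rev` (K2E3-p10) gives, for every non-degenerate hermitian `J` over a field with involution and
`2 ≠ 0`, data `(r, m, e, T, Han)` with `formCongr σ T J = wittFormOn e Han` — by `rfl` on the right-hand side (`wittForm_eq`).

SIMPLE ROOTS AND STANDARD PARABOLICS (typed in part 2∕2 ★ `K2E3LocalUnitaryWittParabolicDefs`, same namespace).  Simple roots are indexed by `Fin r` (`α` ↔ the breakpoint after `e_{α+1}`; `α = r − 1` is the last root, through
`e_r` and the middle block).  `S : Finset (Fin r)` = the simple roots CONTAINED IN the Levi `M_S`; `P_S` stabilises the flag members `V_k = ⟨e₁, …, e_k⟩` at the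
BREAKS `k − 1 ∉ S` (and their orthogonals): `S ⊆ S′ ⇒ P_S ≤ P_{S′}`, `S = univ` gives `U` (`wittParabolic_univ`), `S = ∅` the minimal parabolic (Levi
`(R^×)^r × U(Han)`).  The labelling `wittBlock S : WittIndex r m → Fin (2L+1)` (`L = #{α ∉ S}`) counts breaks (`e_{i+1} ↦ #{α ∉ S | α < i}`, middle `↦ #{α ∉ S}`, `f`-slot
`j ↦ #{α ∉ S} + #{α ∉ S | rev α ≤ j}`); `P_S ∕ M_S ∕ N_S ∕ N_S⁻ ≤ U = unitaryGroupOfForm σ J` are the pull-backs of ★ `standardParabolicGL ∕ standardLeviGL ∕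
unipotentRadicalGL` for `wittBlock S ∘ e.symm` (order-dual for `N_S⁻`), for ANY `J : Matrix n n R` — the parabolics of `U` when `J = wittFormOn e Han`.

WITT COCHARACTERS (this file §2).  `wittCoweight σ α ϖ : WittIndex r m → Rˣ` (`α : Fin r`, `ϖ : Rˣ`) is `ϖ` on `e₁…e_{α+1}`, `(σ ϖ)⁻¹` on the matching `f₁…f_{α+1}`, `1`
elsewhere; `wittCocharacterGL σ e α ϖ := glDiagonal N R (wittCoweight σ α ϖ ∘ e.symm)` and, for an INVOLUTION `σ`, `wittCocharacter σ hσ e Han α ϖ :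
↥(unitaryGroupOfForm σ (wittFormOn e Han))` (membership `wittCocharacterGL_mem`).  They are diagonal, hence commute; `∏_α a_α(ϖ)^{n_α}` is the dominant cone of
the Cartan decomposition `U = K₀ A⁺ K₀ Z` (socket J6), and `a_α(ϖ)` contracts the radical of the maximal parabolic `P_{univ.erase α}` (socket J7).

INTEGRAL LEVEL (this file §3).  Over a valued field `F` (Mathlib `ValuativeRel`): `levelU σ J γ := U ∩ congruenceGL N γ` (names the def-free pattern `(congruenceGL N γ).comap
(unitaryGroupOfForm σ J).subtype` of ★ `UnitaryGroupRayJacquetCriterionAnyRank`) and `maximalCompact σ J := levelU σ J 1 = U ∩ GL_N(𝒪)` (the `K₀` of J6∕J7).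

HONEST LABEL: HC_CM is proved only modulo the 7 printed citations (2 remaining named inputs: hLiu418 = stmt-HodgeConjecture-24832, h413 =
stmt-HodgeConjecture-24833) until rung 0 closes; this file is count-neutral (definitions only).

## References
* [Dieudonne1971GroupesClassiques] J. Dieudonné, *La géométrie des groupes classiques*, 3e éd. (1971), Chap. I §11 (Witt decomposition of hermitian forms).
* [Borel1991] A. Borel, *Linear Algebraic Groups*, 2nd ed. (1991), §23 (relative root systems, standard parabolics; unitary groups as examples).
* [BernsteinZelevinsky1977] I. N. Bernstein, A. V. Zelevinsky, Ann. Sci. ÉNS 10 (1977), §2.1 (standard parabolics `P = M ⋉ U` of `GL_n` by blocks).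
* [Rogawski1990] J. Rogawski, *Automorphic Representations of Unitary Groups in Three Variables* (1990), §1.10 p. 9 (Borel, torus, radical of `U(3)`).
* [Casselman1995] W. Casselman, *Introduction to the theory of admissible representations of p-adic reductive groups* (1995 notes), §1.4 (congruence subgroups `GL_n(𝒪)`, `K_m`).
-/

set_option autoImplicit false
-- the mandated namespace repeats `HodgeConjecture.HodgeConjecture`, as in every `Theorems/*.lean` of this sub-problem
set_option linter.dupNamespace false

namespace Summit.HodgeConjecture.HodgeConjecture.Cruxes.H413.K2E3LocalUnitaryWitt

open Literature.NumberTheory.Automorphic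
open scoped Matrix MatrixGroups

/-! ## §1 The Witt index type and the Witt normal form -/

/-- The **Witt index type** `Fin r ⊕ (Fin m ⊕ Fin r)`: ordered basis `(e₁…e_r ∣ u₁…u_m ∣ f_r…f₁)` of a hermitian space of Witt index `r` with anisotropic
kernel of dimension `m` (the `f`-slots reversed: slot `j` holds `f_{rev j}`). [cite: Dieudonne1971GroupesClassiques, Chap. I §11] -/
abbrev WittIndex (r m : ℕ) : Type := Fin r ⊕ (Fin m ⊕ Fin r)

section Form

variable (R : Type*) [Zero R] [One R]

/-- The **pairing block** `(δ_{i, rev j})_{i j} ∈ M_r(R)` (antidiagonal ones): `e_i` pairs with the `f`-slot `rev i`, which holds `f_i`.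
[cite: Dieudonne1971GroupesClassiques, Chap. I §11] -/
def wittPairing (r : ℕ) : Matrix (Fin r) (Fin r) R := Matrix.of fun i j => if i = Fin.rev j then (1 : R) else 0

variable {R}

/-- The **Witt normal form** `W(r, Han)` on `WittIndex r m`: zero on `e × e` and `f × f`, the pairing block `(δ_{i, rev j})` on `e × f` and its transpose
on `f × e`, the anisotropic kernel `Han` on `u × u`, zero elsewhere. [cite: Dieudonne1971GroupesClassiques, Chap. I §11] -/
def wittForm (r : ℕ) {m : ℕ} (Han : Matrix (Fin m) (Fin m) R) : Matrix (WittIndex r m) (WittIndex r m) R :=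
  Matrix.fromBlocks (0 : Matrix (Fin r) (Fin r) R)
    (Matrix.fromCols (0 : Matrix (Fin r) (Fin m) R) (wittPairing R r))
    (Matrix.fromRows (0 : Matrix (Fin m) (Fin r) R) (wittPairing R r))
    (Matrix.fromBlocks Han 0 0 (0 : Matrix (Fin r) (Fin r) R))

/-- DOCKING (`rfl`): `wittForm r Han` is literally the block matrix of ★ `K2E3HermitianWittBasis.exists_GL_formCongr_eq_wittMatrix_rev`.
[cite: Dieudonne1971GroupesClassiques, Chap. I §11] -/
theorem wittForm_eq (r : ℕ) {m : ℕ} (Han : Matrix (Fin m) (Fin m) R) :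
    wittForm r Han = Matrix.fromBlocks (0 : Matrix (Fin r) (Fin r) R)
      (Matrix.fromCols (0 : Matrix (Fin r) (Fin m) R) (Matrix.of fun i j : Fin r => if i = Fin.rev j then (1 : R) else 0))
      (Matrix.fromRows (0 : Matrix (Fin m) (Fin r) R) (Matrix.of fun i j : Fin r => if i = Fin.rev j then (1 : R) else 0))
      (Matrix.fromBlocks Han 0 0 (0 : Matrix (Fin r) (Fin r) R)) := rfl

variable (r : ℕ) {m : ℕ} (Han : Matrix (Fin m) (Fin m) R)

/-- `W(e_i, e_{i'}) = 0`. [cite: Dieudonne1971GroupesClassiques, Chap. I §11] -/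
@[simp] theorem wittForm_inl_inl (i i' : Fin r) : wittForm r Han (Sum.inl i) (Sum.inl i') = 0 := rfl

/-- `W(e_i, u) = 0`. [cite: Dieudonne1971GroupesClassiques, Chap. I §11] -/
@[simp] theorem wittForm_inl_inr_inl (i : Fin r) (u : Fin m) : wittForm r Han (Sum.inl i) (Sum.inr (Sum.inl u)) = 0 := rfl

/-- `W(e_i, f-slot j) = δ_{i, rev j}`. [cite: Dieudonne1971GroupesClassiques, Chap. I §11] -/
@[simp] theorem wittForm_inl_inr_inr (i j : Fin r) : wittForm r Han (Sum.inl i) (Sum.inr (Sum.inr j)) = if i = Fin.rev j then (1 : R) else 0 := rfl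

/-- `W(u, e_i) = 0`. [cite: Dieudonne1971GroupesClassiques, Chap. I §11] -/
@[simp] theorem wittForm_inr_inl_inl (u : Fin m) (i : Fin r) : wittForm r Han (Sum.inr (Sum.inl u)) (Sum.inl i) = 0 := rfl

/-- `W(u, u') = Han u u'`. [cite: Dieudonne1971GroupesClassiques, Chap. I §11] -/
@[simp] theorem wittForm_inr_inl_inr_inl (u u' : Fin m) : wittForm r Han (Sum.inr (Sum.inl u)) (Sum.inr (Sum.inl u')) = Han u u' := rfl

/-- `W(u, f-slot j) = 0`. [cite: Dieudonne1971GroupesClassiques, Chap. I §11] -/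
@[simp] theorem wittForm_inr_inl_inr_inr (u : Fin m) (j : Fin r) : wittForm r Han (Sum.inr (Sum.inl u)) (Sum.inr (Sum.inr j)) = 0 := rfl

/-- `W(f-slot j, e_i) = δ_{j, rev i}`. [cite: Dieudonne1971GroupesClassiques, Chap. I §11] -/
@[simp] theorem wittForm_inr_inr_inl (j i : Fin r) : wittForm r Han (Sum.inr (Sum.inr j)) (Sum.inl i) = if j = Fin.rev i then (1 : R) else 0 := rfl

/-- `W(f-slot j, u) = 0`. [cite: Dieudonne1971GroupesClassiques, Chap. I §11] -/
@[simp] theorem wittForm_inr_inr_inr_inl (j : Fin r) (u : Fin m) : wittForm r Han (Sum.inr (Sum.inr j)) (Sum.inr (Sum.inl u)) = 0 := rfl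

/-- `W(f-slot j, f-slot j') = 0`. [cite: Dieudonne1971GroupesClassiques, Chap. I §11] -/
@[simp] theorem wittForm_inr_inr_inr_inr (j j' : Fin r) : wittForm r Han (Sum.inr (Sum.inr j)) (Sum.inr (Sum.inr j')) = 0 := rfl

variable {r}

/-- The Witt normal form transported to a carrier `n` (e.g. `Fin N`, `N = 2r + m`) along `e : WittIndex r m ≃ n`: `reindex e e (wittForm r Han)`.
[cite: Dieudonne1971GroupesClassiques, Chap. I §11] -/
def wittFormOn {n : Type*} (e : WittIndex r m ≃ n) (Han : Matrix (Fin m) (Fin m) R) : Matrix n n R :=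
  Matrix.reindex e e (wittForm r Han)

/-- Entries of the transported form: `wittFormOn e Han a b = wittForm r Han (e⁻¹ a) (e⁻¹ b)` (`rfl`). [cite: Dieudonne1971GroupesClassiques, Chap. I §11] -/
@[simp] theorem wittFormOn_apply {n : Type*} (e : WittIndex r m ≃ n) (Han : Matrix (Fin m) (Fin m) R) (a b : n) :
    wittFormOn e Han a b = wittForm r Han (e.symm a) (e.symm b) := rfl

end Form

/-! ## §2 Witt cocharacters -/

section Cocharacters

variable {R : Type*} [CommRing R] (σ : R →+* R) {r m : ℕ}

/-- The **Witt coweight** of the simple root `α : Fin r` at `ϖ : Rˣ`: `ϖ` on `e₁, …, e_{α+1}`, `1` on `e_{α+2}, …, e_r` and on the middle block, `(σ ϖ)⁻¹` on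
the matching slots `f₁, …, f_{α+1}` (slot `j` holds `f_{rev j}`), `1` on the other `f`-slots. [cite: Borel1991, §23] -/
def wittCoweight (α : Fin r) (ϖ : Rˣ) : WittIndex r m → Rˣ
  | Sum.inl i => if i.val ≤ α.val then ϖ else 1
  | Sum.inr (Sum.inl _) => 1
  | Sum.inr (Sum.inr j) => if (Fin.rev j).val ≤ α.val then (Units.map (σ : R →* R) ϖ)⁻¹ else 1

/-- `wittCoweight σ α ϖ (e-index i) = if i ≤ α then ϖ else 1` (`rfl`). [cite: Borel1991, §23] -/
@[simp] theorem wittCoweight_inl (α : Fin r) (ϖ : Rˣ) (i : Fin r) : wittCoweight (m := m) σ α ϖ (Sum.inl i) = if i.val ≤ α.val then ϖ else 1 := rfl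

/-- `wittCoweight σ α ϖ (middle index) = 1` (`rfl`). [cite: Borel1991, §23] -/
@[simp] theorem wittCoweight_inr_inl (α : Fin r) (ϖ : Rˣ) (u : Fin m) : wittCoweight σ α ϖ (Sum.inr (Sum.inl u)) = 1 := rfl

/-- `wittCoweight σ α ϖ (f-slot j) = if rev j ≤ α then (σ ϖ)⁻¹ else 1` (`rfl`). [cite: Borel1991, §23] -/
@[simp] theorem wittCoweight_inr_inr (α : Fin r) (ϖ : Rˣ) (j : Fin r) :
    wittCoweight (m := m) σ α ϖ (Sum.inr (Sum.inr j)) = if (Fin.rev j).val ≤ α.val then (Units.map (σ : R →* R) ϖ)⁻¹ else 1 := rfl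

/-- **A diagonal matrix is unitary for `J` as soon as `σ(d_a) d_b = 1` whenever `J_{ab} ≠ 0`** (entrywise: `(ᵗ(σD) J D)_{ab} = σ(d_a) J_{ab} d_b`).
[cite: Rogawski1990, §1.10 p. 9] -/
theorem glDiagonal_mem_unitaryGroupOfForm {N : ℕ} (J : Matrix (Fin N) (Fin N) R) (d : Fin N → Rˣ)
    (hd : ∀ a b, J a b ≠ 0 → σ (d a : R) * d b = 1) : glDiagonal N R d ∈ unitaryGroupOfForm σ J := by
  rw [mem_unitaryGroupOfForm_iff, coe_glDiagonal]
  have h1 : ((Matrix.diagonal fun k => (d k : R)).map σ)ᵀ = Matrix.diagonal fun k => σ (d k : R) := by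
    rw [Matrix.diagonal_map (map_zero σ), Matrix.diagonal_transpose]
  rw [h1]
  ext a b
  rw [Matrix.mul_diagonal, Matrix.diagonal_mul]
  by_cases hab : J a b = 0
  · rw [hab, mul_zero, zero_mul]
  · rw [mul_right_comm, hd a b hab, one_mul]

/-- **On each non-zero entry of the Witt form the coweights cancel**: `σ(w_x) w_y = 1` whenever `W(r, Han)_{xy} ≠ 0` (`σ` an involution; on a hyperbolic
pair `σ(ϖ)(σϖ)⁻¹ = 1`, resp. `σ((σϖ)⁻¹) ϖ = ϖ⁻¹ ϖ = 1`; on the middle block `σ(1)·1 = 1`). [cite: Borel1991, §23] -/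
theorem wittCoweight_cancel (hσ : ∀ a, σ (σ a) = a) (Han : Matrix (Fin m) (Fin m) R) (α : Fin r) (ϖ : Rˣ)
    (x y : WittIndex r m) (hxy : wittForm r Han x y ≠ 0) :
    σ (wittCoweight σ α ϖ x : R) * (wittCoweight σ α ϖ y : R) = 1 := by
  have hmap : Units.map (σ : R →* R) (Units.map (σ : R →* R) ϖ) = ϖ := Units.ext (by simp [hσ])
  have hpair₁ : σ (ϖ : R) * ((Units.map (σ : R →* R) ϖ)⁻¹ : Rˣ) = 1 := by
    rw [show σ (ϖ : R) = ((Units.map (σ : R →* R) ϖ : Rˣ) : R) from rfl, Units.mul_inv]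
  have hpair₂ : σ (((Units.map (σ : R →* R) ϖ)⁻¹ : Rˣ) : R) * (ϖ : R) = 1 := by
    rw [show σ (((Units.map (σ : R →* R) ϖ)⁻¹ : Rˣ) : R) = ((Units.map (σ : R →* R) ((Units.map (σ : R →* R) ϖ)⁻¹) : Rˣ) : R) from rfl,
      map_inv, hmap, Units.inv_mul]
  rcases x with i | u | j <;> rcases y with i' | u' | j'
  · exact absurd (wittForm_inl_inl r Han i i') hxy
  · exact absurd (wittForm_inl_inr_inl r Han i u') hxy
  · rw [wittForm_inl_inr_inr] at hxy
    have hi : i = Fin.rev j' := by by_contra h; exact hxy (if_neg h)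
    subst hi
    rw [wittCoweight_inl, wittCoweight_inr_inr]
    by_cases hc : (Fin.rev j').val ≤ α.val
    · rw [if_pos hc, if_pos hc]; exact hpair₁
    · rw [if_neg hc, if_neg hc, Units.val_one, map_one, one_mul]
  · exact absurd (wittForm_inr_inl_inl r Han u i') hxy
  · rw [wittCoweight_inr_inl, wittCoweight_inr_inl, Units.val_one, map_one, one_mul]
  · exact absurd (wittForm_inr_inl_inr_inr r Han u j') hxy
  · rw [wittForm_inr_inr_inl] at hxy
    have hj : j = Fin.rev i' := by by_contra h; exact hxy (if_neg h)
    subst hj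
    rw [wittCoweight_inr_inr, wittCoweight_inl, Fin.rev_rev]
    by_cases hc : i'.val ≤ α.val
    · rw [if_pos hc, if_pos hc]; exact hpair₂
    · rw [if_neg hc, if_neg hc, Units.val_one, map_one, one_mul]
  · exact absurd (wittForm_inr_inr_inr_inl r Han j u') hxy
  · exact absurd (wittForm_inr_inr_inr_inr r Han j j') hxy

variable {N : ℕ}

/-- The **Witt cocharacter as an element of `GL_N(R)`**: the diagonal matrix with entries `wittCoweight σ α ϖ ∘ e⁻¹` (★ `glDiagonal`).
[cite: Borel1991, §23] -/
def wittCocharacterGL (e : WittIndex r m ≃ Fin N) (α : Fin r) (ϖ : Rˣ) : GL (Fin N) R :=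
  glDiagonal N R fun k => wittCoweight σ α ϖ (e.symm k)

/-- The underlying matrix of the Witt cocharacter is `diagonal (wittCoweight σ α ϖ ∘ e⁻¹)`. [cite: Borel1991, §23] -/
@[simp] theorem coe_wittCocharacterGL (e : WittIndex r m ≃ Fin N) (α : Fin r) (ϖ : Rˣ) :
    ((wittCocharacterGL σ e α ϖ : GL (Fin N) R) : Matrix (Fin N) (Fin N) R) = Matrix.diagonal fun k => (wittCoweight σ α ϖ (e.symm k) : R) := rfl

/-- **The Witt cocharacter is unitary** for the Witt form `wittFormOn e Han` when `σ` is an involution. [cite: Borel1991, §23] [cite: Rogawski1990, §1.10 p. 9] -/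
theorem wittCocharacterGL_mem (hσ : ∀ a, σ (σ a) = a) (e : WittIndex r m ≃ Fin N) (Han : Matrix (Fin m) (Fin m) R) (α : Fin r) (ϖ : Rˣ) :
    wittCocharacterGL σ e α ϖ ∈ unitaryGroupOfForm σ (wittFormOn e Han) :=
  glDiagonal_mem_unitaryGroupOfForm σ _ _ fun a b hab => wittCoweight_cancel σ hσ Han α ϖ (e.symm a) (e.symm b) hab

/-- The **Witt cocharacter `a_α(ϖ) ∈ U(σ, W(r, Han))`** of the simple root `α` (`σ` an involution): `diag(ϖ on e₁…e_{α+1}, 1, (σϖ)⁻¹ on f₁…f_{α+1})`.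
The `r` of them are diagonal, hence commute; `∏_α a_α(ϖ)^{n_α}` (`n_α ≥ 0`, `ϖ` a uniformiser) is the dominant cone of the Cartan decomposition
`U = K₀ A⁺ K₀ Z`. [cite: Borel1991, §23] -/
def wittCocharacter (hσ : ∀ a, σ (σ a) = a) (e : WittIndex r m ≃ Fin N) (Han : Matrix (Fin m) (Fin m) R) (α : Fin r) (ϖ : Rˣ) :
    ↥(unitaryGroupOfForm σ (wittFormOn e Han)) :=
  ⟨wittCocharacterGL σ e α ϖ, wittCocharacterGL_mem σ hσ e Han α ϖ⟩

/-- The underlying `GL_N` element of `wittCocharacter` is `wittCocharacterGL` (`rfl`). [cite: Borel1991, §23] -/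
@[simp] theorem coe_wittCocharacter (hσ : ∀ a, σ (σ a) = a) (e : WittIndex r m ≃ Fin N) (Han : Matrix (Fin m) (Fin m) R) (α : Fin r) (ϖ : Rˣ) :
    ((wittCocharacter σ hσ e Han α ϖ : ↥(unitaryGroupOfForm σ (wittFormOn e Han))) : GL (Fin N) R) = wittCocharacterGL σ e α ϖ := rfl

end Cocharacters

/-! ## §3 The integral level `K₀ = U ∩ GL_N(𝒪)` and the congruence levels `U ∩ K_γ` -/

section Level

open ValuativeRel

variable {F : Type*} [Field F] [ValuativeRel F] (σ : F →+* F) {N : ℕ} (J : Matrix (Fin N) (Fin N) F)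

/-- The **congruence level `U ∩ K_γ`** of `U(σ, J)(F)` over a valued field: pull-back of ★ `congruenceGL N γ` (integral with integral inverse and `≡ 1`
to precision `γ`; `γ ≥ 1` gives `GL_N(𝒪)`).  Names the def-free pattern `(congruenceGL N γ).comap (unitaryGroupOfForm σ J).subtype` of ★
`UnitaryGroupRayJacquetCriterionAnyRank`. [cite: Casselman1995, §1.4] -/
def levelU (γ : ValueGroupWithZero F) : Subgroup ↥(unitaryGroupOfForm σ J) :=
  (congruenceGL N γ).comap (unitaryGroupOfForm σ J).subtype

/-- **`K₀ = U ∩ GL_N(𝒪)`**, the integral level (`levelU σ J 1`); for `J = wittFormOn e Han` with `Han` integral and unimodular this is the special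
maximal compact subgroup of the Cartan decomposition `U = K₀ A⁺ K₀ Z` (socket J6). [cite: Casselman1995, §1.4] [cite: Borel1991, §23] -/
def maximalCompact : Subgroup ↥(unitaryGroupOfForm σ J) := levelU σ J 1

variable {σ J}

/-- Membership in `U ∩ K_γ`: the underlying `GL_N` element lies in ★ `congruenceGL N γ`. [cite: Casselman1995, §1.4] -/
theorem mem_levelU_iff (γ : ValueGroupWithZero F) (g : ↥(unitaryGroupOfForm σ J)) :
    g ∈ levelU σ J γ ↔ (g : GL (Fin N) F) ∈ congruenceGL N γ := Iff.rfl

/-- Membership in `K₀`: the underlying `GL_N` element lies in `GL_N(𝒪) = congruenceGL N 1`. [cite: Casselman1995, §1.4] -/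
theorem mem_maximalCompact_iff (g : ↥(unitaryGroupOfForm σ J)) :
    g ∈ maximalCompact σ J ↔ (g : GL (Fin N) F) ∈ congruenceGL N 1 := Iff.rfl

variable (σ J)

/-- `levelU σ J γ` IS the def-free pattern `(congruenceGL N γ).comap U.subtype` (`rfl`; docking with ★ `UnitaryGroupRayJacquetCriterionAnyRank`);
in particular `maximalCompact σ J = (congruenceGL N 1).comap U.subtype` by `rfl`. [cite: Casselman1995, §1.4] -/
theorem levelU_eq_comap (γ : ValueGroupWithZero F) : levelU σ J γ = (congruenceGL N γ).comap (unitaryGroupOfForm σ J).subtype := rfl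

/-- The levels are monotone in `γ` (★ `congruenceGL` is). [cite: Casselman1995, §1.4] -/
theorem levelU_mono {γ δ : ValueGroupWithZero F} (h : γ ≤ δ) : levelU σ J γ ≤ levelU σ J δ :=
  Subgroup.comap_mono (congruenceGL_mono (n := N) h)

end Level

end Summit.HodgeConjecture.HodgeConjecture.Cruxes.H413.K2E3LocalUnitaryWitt
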